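/-
Copyright (c) 2026. All rights reserved.
Released under Apache 2.0 license as described in the file LICENSE.
-/
import Literature.NumberTheory.QuadraticFields.JacobiTwoSquares
import HarnessLib

/-!
# The number of representations as a sum of two triangular numbers: `δ₂(n) = r₂(8n+2)/4 = d₁(4n+1) − d₃(4n+1)`

`δ₂(n) = #{(a, b) ∈ ℕ² : T_a + T_b = n}`, `T_a = a(a+1)/2` (ordered pairs). Ono–Robins–Wahl's Proposition 2
(`δ_k(n) = q_k(8n + k)`) and their §3, the case `k = 2` («if `α² + β² ≡ 2 (mod 8)` then `α` and `β` are necessarily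
odd. Consequently `δ₂(n) = q₂(8n+2) = ¼ r₂(8n+2)`. The scalar `¼` compensates for the 4 possible choices of sign»),
combined with Jacobi's `r₂(m) = 4(d₁(m) − d₃(m))` of the tree (`QuadraticFields/JacobiTwoSquares`, Hardy–Wright
Thm. 278) give their Theorem 1 ∕ Corollary 1:

  `δ₂(n) = d₁(8n + 2) − d₃(8n + 2) = d₁(4n + 1) − d₃(4n + 1)`,

`d_a(m)` the number of divisors of `m` congruent to `a (mod 4)`.

* §1 (private parity plumbing), **`card_circle_eq_four_mul_card_triangular`** (`r₂(8n+2) = 4·δ₂(n)`, an explicit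
  equivalence with two sign bits);
* §2 **`card_triangular_two_eq`** (`δ₂(n) = d₁(8n+2) − d₃(8n+2)`), **`card_triangular_two_eq'`** (`= d₁(4n+1) −
  d₃(4n+1)`, through the tree's `card_normEq_two_mul`), values `δ₂(0) = 1`, `δ₂(1) = 2`.

## Sources

* K. Ono, S. Robins, P. T. Wahl, *On the representation of integers as sums of triangular numbers*, Aequationes
  Math. 50 (1995) 73–94, §2 Prop. 2 and §3 (the case `k = 2`, Theorem 1: `δ₂(n) = d(n₁) = d₁(8n+2) − d₃(8n+2)`).
  [cite: OnoRobinsWahl1995, §2 Prop. 2; §3 Thm. 1]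
* G. H. Hardy, E. M. Wright, *An Introduction to the Theory of Numbers*, Thm. 278 (`r(n) = 4(d₁(n) − d₃(n))`).
  [cite: HardyWright2008, Thm 278]

## Scope (honest)

Theorems only — no definition, no named fact, no instance. Pairs are ordered and range over `ℕ²`; `r₂` is read on
`ℤ²` and converted to the tree's `#(normEq m)` by `card_normEq_eq_ncard_setOf_sq_add_sq`.
-/

open Finset
open Literature.NumberTheory.QuadraticFields.GaussianPrimary
open Literature.NumberTheory.LFunctions.GaussianTheta (normEq)

namespace Literature.NumberTheory.Waring.TwoTriangularNumbersCount

/-! ## §1 `r₂(8n + 2) = 4·δ₂(n)` -/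

section Bijection

/-- `u² + v² = 8n + 2` in `ℕ` forces `u`, `v` odd («α and β are necessarily odd»). [cite: OnoRobinsWahl1995, §3 (k = 2)] -/
private theorem odd_of_sq_add_sq {u v n : ℕ} (h : u ^ 2 + v ^ 2 = 8 * n + 2) : u % 2 = 1 ∧ v % 2 = 1 := by
  rcases Nat.even_or_odd u with ⟨a, rfl⟩ | ⟨a, rfl⟩ <;> rcases Nat.even_or_odd v with ⟨b, rfl⟩ | ⟨b, rfl⟩
  · have e : (a + a) ^ 2 + (b + b) ^ 2 = 4 * (a * a + b * b) := by ring
    rw [e] at h; omega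
  · have e : (a + a) ^ 2 + (2 * b + 1) ^ 2 = 4 * (a * a + b * b + b) + 1 := by ring
    rw [e] at h; omega
  · have e : (2 * a + 1) ^ 2 + (b + b) ^ 2 = 4 * (a * a + a + b * b) + 1 := by ring
    rw [e] at h; omega
  · exact ⟨by omega, by omega⟩

/-- `Σ uᵢ² = 8n + 2` in `ℕ` gives `Σ T_{(uᵢ−1)/2} = n`. [folklore] -/
private theorem tri_of_sq {u v n : ℕ} (h : u ^ 2 + v ^ 2 = 8 * n + 2) :
    u / 2 * (u / 2 + 1) / 2 + v / 2 * (v / 2 + 1) / 2 = n := by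
  obtain ⟨hu, hv⟩ := odd_of_sq_add_sq h
  obtain ⟨p, rfl⟩ : ∃ p, u = 2 * p + 1 := ⟨u / 2, by omega⟩
  obtain ⟨q, rfl⟩ : ∃ q, v = 2 * q + 1 := ⟨v / 2, by omega⟩
  have e1 : (2 * p + 1) / 2 = p := by omega
  have e2 : (2 * q + 1) / 2 = q := by omega
  rw [e1, e2]
  have key : p * (p + 1) + q * (q + 1) = 2 * n := by nlinarith [h]
  obtain ⟨kp, hkp⟩ := Nat.even_mul_succ_self p
  obtain ⟨kq, hkq⟩ := Nat.even_mul_succ_self q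
  generalize p * (p + 1) = P at hkp key ⊢
  generalize q * (q + 1) = Q at hkq key ⊢
  omega

/-- `Σ T_{xᵢ} = n` gives `Σ (2xᵢ + 1)² = 8n + 2`. [folklore] -/
private theorem sq_of_tri {p q n : ℕ} (h : p * (p + 1) / 2 + q * (q + 1) / 2 = n) :
    (2 * p + 1) ^ 2 + (2 * q + 1) ^ 2 = 8 * n + 2 := by
  obtain ⟨kp, hkp⟩ := Nat.even_mul_succ_self p
  obtain ⟨kq, hkq⟩ := Nat.even_mul_succ_self q
  have key : p * (p + 1) + q * (q + 1) = 2 * n := by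
    have hp' := hkp; have hq' := hkq
    generalize p * (p + 1) = P at hp' h ⊢
    generalize q * (q + 1) = Q at hq' h ⊢
    omega
  nlinarith [key]

/-- `(±z)² = z²`. [folklore] -/
private theorem sq_bif_neg (b : Bool) (z : ℤ) : (bif b then -z else z) ^ 2 = z ^ 2 := by
  cases b <;> simp

/-- `|±m| = m`. [folklore] -/
private theorem natAbs_bif_neg (b : Bool) (m : ℕ) : (bif b then -(m : ℤ) else (m : ℤ)).natAbs = m := by
  cases b <;> simp

/-- The sign of `±(2p + 1)` is `b`. [folklore] -/
private theorem decide_bif_neg (b : Bool) (p : ℕ) :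
    decide ((bif b then -(((2 * p + 1 : ℕ)) : ℤ) else ((2 * p + 1 : ℕ) : ℤ)) < 0) = b := by
  cases b
  · simp only [cond_false, decide_eq_false_iff_not, not_lt]
    positivity
  · simp only [cond_true, decide_eq_true_eq, Left.neg_neg_iff]
    positivity

/-- An odd integer is `±(2·(|z|/2) + 1)` with the sign read off `z < 0`. [folklore] -/
private theorem bif_decide_eq (z : ℤ) (hz : z.natAbs % 2 = 1) :
    (bif decide (z < 0) then -(((2 * (z.natAbs / 2) + 1 : ℕ)) : ℤ) else ((2 * (z.natAbs / 2) + 1 : ℕ) : ℤ)) = z := by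
  by_cases h : z < 0
  · rw [decide_eq_true h, cond_true]
    omega
  · rw [decide_eq_false h, cond_false]
    omega

/-- **`r₂(8n + 2) = 4·δ₂(n)`** (Ono–Robins–Wahl Prop. 2 and §3, `k = 2`: «`δ₂(n) = q₂(8n+2) = ¼ r₂(8n+2)`. The scalar
`¼` compensates for the 4 possible choices of sign»): the explicit equivalence `{y ∈ ℤ² : y₁² + y₂² = 8n+2} ≃
{x ∈ ℕ² : T_{x₁} + T_{x₂} = n} × Bool²`. [cite: OnoRobinsWahl1995, §2 Prop. 2 and §3 (k = 2)] -/
theorem card_circle_eq_four_mul_card_triangular (n : ℕ) :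
    Nat.card {y : ℤ × ℤ // y.1 ^ 2 + y.2 ^ 2 = ((8 * n + 2 : ℕ) : ℤ)} =
      4 * Nat.card {x : ℕ × ℕ // x.1 * (x.1 + 1) / 2 + x.2 * (x.2 + 1) / 2 = n} := by
  have habs : ∀ y : {y : ℤ × ℤ // y.1 ^ 2 + y.2 ^ 2 = ((8 * n + 2 : ℕ) : ℤ)},
      y.1.1.natAbs ^ 2 + y.1.2.natAbs ^ 2 = 8 * n + 2 := by
    rintro ⟨⟨a, b⟩, h⟩
    apply Nat.cast_injective (R := ℤ)
    rw [Nat.cast_add, Nat.cast_pow, Nat.cast_pow, Int.natAbs_sq, Int.natAbs_sq]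
    exact h
  let e : {y : ℤ × ℤ // y.1 ^ 2 + y.2 ^ 2 = ((8 * n + 2 : ℕ) : ℤ)} ≃
      {x : ℕ × ℕ // x.1 * (x.1 + 1) / 2 + x.2 * (x.2 + 1) / 2 = n} × (Bool × Bool) :=
    { toFun := fun y =>
        (⟨(y.1.1.natAbs / 2, y.1.2.natAbs / 2), tri_of_sq (habs y)⟩, (decide (y.1.1 < 0), decide (y.1.2 < 0)))
      invFun := fun x =>
        ⟨((bif x.2.1 then -(((2 * x.1.1.1 + 1 : ℕ)) : ℤ) else ((2 * x.1.1.1 + 1 : ℕ) : ℤ)),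
            (bif x.2.2 then -(((2 * x.1.1.2 + 1 : ℕ)) : ℤ) else ((2 * x.1.1.2 + 1 : ℕ) : ℤ))), by
          dsimp only
          rw [sq_bif_neg, sq_bif_neg]
          exact_mod_cast sq_of_tri x.1.2⟩
      left_inv := by
        rintro ⟨⟨a, b⟩, h⟩
        obtain ⟨ha, hb⟩ := odd_of_sq_add_sq (habs ⟨(a, b), h⟩)
        dsimp only at ha hb
        apply Subtype.ext
        dsimp only
        rw [bif_decide_eq a ha, bif_decide_eq b hb]
      right_inv := by
        rintro ⟨⟨⟨p, q⟩, hx⟩, b₁, b₂⟩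
        dsimp only
        have e1 : (2 * p + 1) / 2 = p := by omega
        have e2 : (2 * q + 1) / 2 = q := by omega
        refine Prod.ext (Subtype.ext ?_) ?_
        · dsimp only
          rw [natAbs_bif_neg, natAbs_bif_neg, e1, e2]
        · rw [decide_bif_neg, decide_bif_neg] }
  rw [Nat.card_congr e, Nat.card_prod, Nat.card_prod, Nat.card_eq_fintype_card (α := Bool), Fintype.card_bool]
  ring

end Bijection

/-! ## §2 `δ₂(n) = d₁(8n+2) − d₃(8n+2) = d₁(4n+1) − d₃(4n+1)` -/

section Count

/-- `r₂` on `ℤ²` is the tree's `#(normEq m)`. [cite: HardyWright2008, §16.9] -/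
private theorem card_circle_eq_card_normEq (m : ℕ) :
    Nat.card {y : ℤ × ℤ // y.1 ^ 2 + y.2 ^ 2 = (m : ℤ)} = #(normEq m) := by
  rw [card_normEq_eq_ncard_setOf_sq_add_sq, ← Nat.card_coe_set_eq]
  rfl

/-- **ONO–ROBINS–WAHL, THEOREM 1: `δ₂(n) = d₁(8n + 2) − d₃(8n + 2)`** (`d_a(m)` = the number of divisors of `m`
congruent to `a (mod 4)`), from `4·δ₂(n) = r₂(8n+2) = 4(d₁ − d₃)(8n+2)` (Jacobi ∕ Hardy–Wright Thm. 278 of the tree).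
[cite: OnoRobinsWahl1995, §3 Thm. 1] [cite: HardyWright2008, Thm 278] -/
theorem card_triangular_two_eq (n : ℕ) :
    Nat.card {x : ℕ × ℕ // x.1 * (x.1 + 1) / 2 + x.2 * (x.2 + 1) / 2 = n} =
      #{d ∈ (8 * n + 2).divisors | d % 4 = 1} - #{d ∈ (8 * n + 2).divisors | d % 4 = 3} := by
  have h := card_circle_eq_four_mul_card_triangular n
  rw [card_circle_eq_card_normEq, card_normEq_eq_four_mul_card_sub_card (by omega)] at h
  omega

/-- **… `= d₁(4n + 1) − d₃(4n + 1)`** (the odd part: `r₂(2m) = r₂(m)`, the tree's `card_normEq_two_mul`; Ono–Robins–Wahl's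
`δ₂(n) = d(n₁)` form counts the divisors of the odd kernel). [cite: OnoRobinsWahl1995, §3 Thm. 1]
[cite: HardyWright2008, Thm 278 and §16.10] -/
theorem card_triangular_two_eq' (n : ℕ) :
    Nat.card {x : ℕ × ℕ // x.1 * (x.1 + 1) / 2 + x.2 * (x.2 + 1) / 2 = n} =
      #{d ∈ (4 * n + 1).divisors | d % 4 = 1} - #{d ∈ (4 * n + 1).divisors | d % 4 = 3} := by
  have h := card_circle_eq_four_mul_card_triangular n
  rw [card_circle_eq_card_normEq, show 8 * n + 2 = 2 * (4 * n + 1) by ring, card_normEq_two_mul,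
    card_normEq_eq_four_mul_card_sub_card (by omega)] at h
  omega

/-- `δ₂(0) = 1` (`0 = T₀ + T₀`; `d₁(1) − d₃(1) = 1`). [cite: OnoRobinsWahl1995, §1 (T₀ = 0)] -/
theorem card_triangular_two_zero :
    Nat.card {x : ℕ × ℕ // x.1 * (x.1 + 1) / 2 + x.2 * (x.2 + 1) / 2 = 0} = 1 := by
  rw [card_triangular_two_eq' 0]
  decide

/-- `δ₂(1) = 2` (`1 = T₁ + T₀ = T₀ + T₁`; `d₁(5) − d₃(5) = 2`). [cite: OnoRobinsWahl1995, §1 (T₁ = 1)] -/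
theorem card_triangular_two_one :
    Nat.card {x : ℕ × ℕ // x.1 * (x.1 + 1) / 2 + x.2 * (x.2 + 1) / 2 = 1} = 2 := by
  rw [card_triangular_two_eq' 1]
  decide

end Count

end Literature.NumberTheory.Waring.TwoTriangularNumbersCount
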